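import Summits.BirchSwinnertonDyer.Rank1Residual.P2.CongruentNumberSilentEvenFiveThetaGaloisBookkeeping
import Literature.NumberTheory.EllipticCurves.TianYuanZhang2017.CMPointGaloisDisplays
import Mathlib.GroupTheory.QuotientGroup.Basic
import HarnessLib

/-!
# Crux `PrintCf2.RamifiedOffTYZOfFacts` (item stmt-BirchSwinnertonDyer-20509; items 23431/23432 of route `PrintCf2` rev ≥ 33),
# line `offtyz-v7`: THEOREM B AT LAYER 1, part 1 (abstract engine) — the transfer identity modulo `Gal(ℍ′_n/H′_d)` and the
# point-side bookkeeping `g·Z = Z + (Σε)·τ(1)` behind «the Galois action on TYZ's genus period is read off ONE power `g^{g(d)}`»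

Cell `bsd-print-cf2`, seat `bsd-print-cf2-ty2` (typer; the DISCHARGE INTERFACE «displayed predicate ⟹ the door's hypothesis»), for the
LEAD's note `Cruxes/RamifiedOffTYZOfFacts/Lines/offtyz_v7_TransferLayer.md` (cruxlead-20509 g4) §2–§3, §8, §10 (b): "THEOREM B is Lemma A
(kernel helper) + bookkeeping".  HONEST FRAMING: theorems only (no `def`, no named fact, no `sorry`); nothing here closes an item; BSD is not
proved by any of this; no class is closed.  beyond-print theorem: NO (Galois bookkeeping of printed sentences).

WHAT.  For a block `d` of `D : GenusPointData n` with the objects `(z, Φ, ΓH, ΓH', σ)` of `GenusPointData.CMBlockSpec` (the tree's display of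
[TianYuanZhang2017] §3.1 / Prop. 3.2 / Thm. 3.6 / p. 759: `Z(d) = Σ_{t∈Φ₀} t·z_d`, `#Φ₀ = g(d)`, `Γ := Gal(ℍ′_n/H′_d)` normal and fixing `z_d`,
`Gal(ℍ′_n/K_d)/Γ` abelian, `σ² ∈ Γ`, `σ·z_d = z_d + τ(1)`, `Φ₀` a set of representatives of `Gal(H′_d/L_d(i))/⟨σ⟩`), and EVERY `g`
trivial on `L_d(i)`:
  **either `g^{g(d)} ∈ Γ` and `g·Z(d) = Z(d)`, or `g^{g(d)} ∈ σΓ` and `g·Z(d) = Z(d) + τ(1)`**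
(sequel file `PrintCf2GenusPeriodTransferLayerBlocks.lean`: `galPt_genusPeriod_dichotomy_of_cmBlockSpec`, `d ≡ 5 (mod 8)`; the note's (B1)/(B2):
the class of `Z(d)` over `L_d(i)` is the character `g ↦ [g^{g(d)} ≡ σ]`), hence `g` MOVES `Z(d)` iff `g^{g(d)} ≡ σ (mod Γ)`.  With the ring class
dictionary of `CMPointRingClassDisplays` (`Gal(H′_d/K_d) ≅ Pic(𝒪₂)`, ty2 g31) this turns «a mover exists» into «`∃ x ∈ Pic(𝒪₂)²` with
`x^{g(d)} = κ`», `κ` the non-trivial element of `ker(Pic(𝒪₂) → Cl)` — the input of the GALOIS-MOVER DOOR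
`GaloisMotion.rankOne_sha_bsdp_two_congruentNumberCurve_of_selmerEight_of_mover` (p672160) per family (sequel file).

HOW (the note's Lemma A, re-derived in the form needed here).  §2 is the transfer identity for an ABELIAN quotient `Q/Γ` in the concrete
shape «if `g t ≡ π(t) σ^{ε(t)} (mod Γ)` for a permutation `π` of `Φ`, then `g^{#Φ} ≡ σ^{Σ ε(t)} (mod Γ)`» (product over `Φ` in the commutative
group `Q/Γ`: `g^{#Φ} ∏ t = ∏ π(t) · σ^{Σε} = ∏ t · σ^{Σε}`) — this is `MonoidHom.transfer_eq_pow` written out for the transversal `Φ`, cf. the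
LEAD's `GenusPeriodTransfer.smul_genusPeriod_eq_add_pow_index` (p670372), whose `DistribMulAction`-on-a-`CommGroup` frame would require
building the quotient action on the `Γ`-invariants; the direct product identity is shorter here.  §3 is the point-side bookkeeping
«`g·Z = Σ_t (g t)·z = Σ_t π(t)·z + (Σ ε(t))·τ(1) = Z + (Σε)·τ(1)`» (route B's `ThetaDescent` congruence lemmas, `thetaPt = galPt`).  §4 builds
`π, ε` from (G7) and proves `π` injective; §5 assembles the dichotomy (parity of `Σε` via `σ² ∈ Γ`, `2τ(1) = 0`, and `σ ∉ Γ` since `σ` moves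
`z`); §6 instantiates at a block `d ≡ 5 (mod 8)` of `CMPointGaloisPrinted` (there `Gal(ℍ′_n/H_d)`, hence `Γ` and `σ`, is trivial on `L_d(i)`:
`trivialOnL_of_fixesGenusField`, `d ≡ 1 (mod 4)`).  THIS FILE = §1–§4 (abstract engine); §5–§6 are the sequel `…TransferLayerBlocks.lean`.

References: [cite: TianYuanZhang2017, §3.1 (p0011 L1–L13, L53–L66), Prop. 3.2 (1) (p0010 L108–L109), Thm. 3.6 (1) (p0012 L27–L29), proof of Lemma 3.21 (p0020 L27–L63)];
the LEAD note (crux dir) §2 (Lemma A), §3 (Theorem B), §8, §10 (b); Mathlib `QuotientGroup`, `Finset.prod_nbij`.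
-/

noncomputable section

open scoped Classical

open WeierstrassCurve WeierstrassCurve.Affine Literature.NumberTheory.EllipticCurves
  Literature.NumberTheory.EllipticCurves.TianYuanZhang2017
  Literature.NumberTheory.EllipticCurves.TianYuanZhang2017.W2

set_option autoImplicit false

namespace Summit.BirchSwinnertonDyer.Rank1Residual.P2.GenusPeriodTransferLayer

open Summit.BirchSwinnertonDyer.Rank1Residual.P2.ThetaDescent

variable {n : ℕ}

/-! ## §1 `galPt` plumbing (`galPt = thetaPt` definitionally) -/

/-- `(g h)·Q = g·(h·Q)`. [cite: TianYuanZhang2017, proof of Lemma 3.21 (p0020 L55–L62)] -/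
theorem galPt_mul (D : GenusPointData n) (g h : D.H ≃ₐ[ℚ] D.H) (Q : APoint D.H) :
    D.galPt (g * h) Q = D.galPt g (D.galPt h Q) :=
  thetaPt_mul D g h Q

/-- `1·Q = Q`. [cite: TianYuanZhang2017, proof of Lemma 3.21 (p0020 L55–L62)] -/
theorem galPt_one (D : GenusPointData n) (Q : APoint D.H) : D.galPt 1 Q = Q :=
  thetaPt_one D Q

/-- `τ(1) = (0,0)` is fixed by every automorphism. [cite: TianYuanZhang2017, §3.2 (p0012 L8–L18)] -/
theorem galPt_tauOne (D : GenusPointData n) (g : D.H ≃ₐ[ℚ] D.H) : D.galPt g tauOne = tauOne :=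
  thetaPt_tauOne' D g

/-- `k·τ(1)` is fixed by every automorphism. [cite: TianYuanZhang2017, §3.2 (p0012 L8–L18)] -/
theorem galPt_nsmul_tauOne (D : GenusPointData n) (g : D.H ≃ₐ[ℚ] D.H) (k : ℕ) :
    D.galPt g (k • (tauOne : APoint D.H)) = k • tauOne := by
  rw [map_nsmul, galPt_tauOne]

/-- `σ·z = z + τ(1)` ⟹ `σᵏ·z = z + k·τ(1)`. [cite: TianYuanZhang2017, Thm. 3.6 (1) (p0012 L27–L29: z_n^{σ_ϖ²} = z_n + τ(1))] -/
theorem galPt_pow_of_eq_add_tauOne (D : GenusPointData n) {σ : D.H ≃ₐ[ℚ] D.H} {z : APoint D.H}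
    (hσz : D.galPt σ z = z + tauOne) (k : ℕ) : D.galPt (σ ^ k) z = z + k • tauOne := by
  induction k with
  | zero => rw [pow_zero, galPt_one, zero_smul, add_zero]
  | succ k ih =>
    rw [pow_succ, galPt_mul, hσz, map_add, ih, galPt_tauOne, add_assoc, ← succ_nsmul]

/-- `(2m)·τ(1) = 0` and `(2m+1)·τ(1) = τ(1)`: `k·τ(1) = (k % 2)·τ(1)`. [cite: TianYuanZhang2017, §3.2 (p0012 L8–L18: 2τ(1) = 0)] -/
theorem nsmul_tauOne_eq_mod_two {H : Type} [Field H] [CharZero H] (k : ℕ) :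
    k • (tauOne : APoint H) = (k % 2) • tauOne := by
  calc k • (tauOne : APoint H) = (2 * (k / 2) + k % 2) • tauOne := by rw [Nat.div_add_mod]
    _ = (k / 2) • ((2 : ℕ) • (tauOne : APoint H)) + (k % 2) • tauOne := by rw [add_smul, mul_comm, mul_smul]
    _ = (k % 2) • tauOne := by rw [two_nsmul_tauOne, smul_zero, zero_add]

/-! ## §2 The transfer identity modulo `Γ` for an abelian quotient (Lemma A in product form) -/

section Transfer

variable {Ω : Type*} [Group Ω]

/-- **Transfer = power, written out.**  Let `Γ ≤ Q ≤ Ω` with `Γ` normalised by `Q` and `Q/Γ` abelian (`hcomm`), `Φ ⊆ Q` finite, `σ, g ∈ Q`,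
and suppose `g t ≡ π(t) σ^{ε(t)} (mod Γ)` for every `t ∈ Φ`, where `π` maps `Φ` injectively into itself.  Then
`g^{#Φ} ≡ σ^{Σ_{t∈Φ} ε(t)} (mod Γ)`.  (In `Q/Γ`: `g^{#Φ}·∏_t t = ∏_t (g t) = ∏_t π(t)·σ^{Σε} = ∏_t t·σ^{Σε}`.)
[cite: TianYuanZhang2017, proof of Lemma 3.21 (p0020 L57–L62: "αΦ₀ is also a set of representatives … αΦ₀ = {σ_i t_i}")] -/
theorem pow_card_mul_inv_pow_sum_mem (Q Γ : Subgroup Ω)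
    (hΓn : ∀ g ∈ Q, ∀ γ ∈ Γ, g * γ * g⁻¹ ∈ Γ) (hcomm : ∀ s ∈ Q, ∀ t ∈ Q, s⁻¹ * t⁻¹ * s * t ∈ Γ)
    (Φ : Finset Ω) (hΦ : ∀ t ∈ Φ, t ∈ Q) {σ g : Ω} (hσ : σ ∈ Q) (hg : g ∈ Q)
    (π : Ω → Ω) (ε : Ω → ℕ) (hπΦ : ∀ t ∈ Φ, π t ∈ Φ) (hπinj : Set.InjOn π Φ)
    (hclass : ∀ t ∈ Φ, g * t * (π t * σ ^ ε t)⁻¹ ∈ Γ) :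
    g ^ Φ.card * (σ ^ (∑ t ∈ Φ, ε t))⁻¹ ∈ Γ := by
  -- the quotient `G = Q / (Γ ∩ Q)` is a commutative group
  set N : Subgroup Q := Γ.subgroupOf Q with hN
  haveI hNn : N.Normal := ⟨fun a ha b => by
    simp only [hN, Subgroup.mem_subgroupOf, Subgroup.coe_mul, Subgroup.coe_inv] at ha ⊢
    exact hΓn _ b.2 _ ha⟩
  letI : CommGroup (Q ⧸ N) :=
    { (inferInstance : Group (Q ⧸ N)) with
      mul_comm := by
        rintro ⟨a⟩ ⟨b⟩
        change (QuotientGroup.mk a : Q ⧸ N) * QuotientGroup.mk b = QuotientGroup.mk b * QuotientGroup.mk a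
        rw [← QuotientGroup.mk_mul, ← QuotientGroup.mk_mul, QuotientGroup.eq, hN, Subgroup.mem_subgroupOf]
        simp only [Subgroup.coe_mul, Subgroup.coe_inv, mul_inv_rev]
        have := hcomm _ b.2 _ a.2
        rwa [show (b : Ω)⁻¹ * (a : Ω)⁻¹ * b * a = (↑b)⁻¹ * (↑a)⁻¹ * (b * a) by group] at this }
  -- the class map on `Ω` (junk value `1` off `Q`)
  let cl : Ω → Q ⧸ N := fun x => if hx : x ∈ Q then (QuotientGroup.mk ⟨x, hx⟩ : Q ⧸ N) else 1
  have cl_of : ∀ {x : Ω} (hx : x ∈ Q), cl x = QuotientGroup.mk ⟨x, hx⟩ := fun hx => dif_pos hx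
  have cl_mul : ∀ {x y : Ω}, x ∈ Q → y ∈ Q → cl (x * y) = cl x * cl y := fun {x y} hx hy => by
    rw [cl_of hx, cl_of hy, cl_of (Q.mul_mem hx hy), ← QuotientGroup.mk_mul]; rfl
  have cl_pow : ∀ {x : Ω}, x ∈ Q → ∀ k : ℕ, cl (x ^ k) = cl x ^ k := fun {x} hx k => by
    induction k with
    | zero => rw [pow_zero, pow_zero, cl_of Q.one_mem]; rfl
    | succ k ih => rw [pow_succ, pow_succ, cl_mul (Q.pow_mem hx k) hx, ih]
  have cl_eq_iff : ∀ {x y : Ω}, x ∈ Q → y ∈ Q → (cl x = cl y ↔ x * y⁻¹ ∈ Γ) := fun {x y} hx hy => by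
    rw [cl_of hx, cl_of hy, QuotientGroup.eq, hN, Subgroup.mem_subgroupOf]
    change x⁻¹ * y ∈ Γ ↔ x * y⁻¹ ∈ Γ
    constructor
    · intro h
      have h' := hΓn x hx _ (Γ.inv_mem h)
      rwa [mul_inv_rev, inv_inv, show x * (y⁻¹ * x) * x⁻¹ = x * y⁻¹ by group] at h'
    · intro h
      have h' := Γ.inv_mem (hΓn x⁻¹ (Q.inv_mem hx) _ h)
      rwa [inv_inv, show (x⁻¹ * (x * y⁻¹) * x)⁻¹ = x⁻¹ * y by group] at h'
  -- the class relation, multiplied over `Φ`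
  have hterm : ∀ t ∈ Φ, cl g * cl t = cl (π t) * cl σ ^ ε t := fun t ht => by
    have hmem : π t * σ ^ ε t ∈ Q := Q.mul_mem (hΦ _ (hπΦ t ht)) (Q.pow_mem hσ _)
    rw [← cl_mul hg (hΦ t ht), ← cl_pow hσ, ← cl_mul (hΦ _ (hπΦ t ht)) (Q.pow_mem hσ _)]
    exact (cl_eq_iff (Q.mul_mem hg (hΦ t ht)) hmem).mpr (hclass t ht)
  have hsurj : Set.SurjOn π Φ Φ := Finset.surjOn_of_injOn_of_card_le π (fun t ht => hπΦ t ht) hπinj le_rfl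
  have hprod : (cl g) ^ Φ.card * ∏ t ∈ Φ, cl t = (∏ t ∈ Φ, cl t) * cl σ ^ (∑ t ∈ Φ, ε t) := by
    calc (cl g) ^ Φ.card * ∏ t ∈ Φ, cl t = ∏ t ∈ Φ, (cl g * cl t) := by
            rw [Finset.prod_mul_distrib, Finset.prod_const]
      _ = ∏ t ∈ Φ, (cl (π t) * cl σ ^ ε t) := Finset.prod_congr rfl hterm
      _ = (∏ t ∈ Φ, cl (π t)) * cl σ ^ (∑ t ∈ Φ, ε t) := by
            rw [Finset.prod_mul_distrib, Finset.prod_pow_eq_pow_sum]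
      _ = (∏ t ∈ Φ, cl t) * cl σ ^ (∑ t ∈ Φ, ε t) := by
            have hre : ∏ t ∈ Φ, cl (π t) = ∏ t ∈ Φ, cl t :=
              Finset.prod_nbij π hπΦ hπinj hsurj (fun _ _ => rfl)
            rw [hre]
  have hcl : cl g ^ Φ.card = cl σ ^ (∑ t ∈ Φ, ε t) := by
    have := hprod
    rw [mul_comm (∏ t ∈ Φ, cl t)] at this
    exact mul_right_cancel this
  rw [← cl_pow hg, ← cl_pow hσ] at hcl
  exact (cl_eq_iff (Q.pow_mem hg _) (Q.pow_mem hσ _)).mp hcl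

end Transfer

/-! ## §3 Point-side bookkeeping: `g·Z = Z + (Σ ε)·τ(1)` -/

section Points

variable (D : GenusPointData n) (Γ : Subgroup (D.H ≃ₐ[ℚ] D.H)) (z : APoint D.H)

/-- **`g·Z = Z + (Σ_t ε(t))·τ(1)`.**  With `Γ` normal and fixing `z`, `σ·z = z + τ(1)`, and `g t ≡ π(t) σ^{ε(t)} (mod Γ)` for a map `π`
sending `Φ` injectively into itself: `g·(Σ_{t∈Φ} t·z) = Σ_{t∈Φ} t·z + (Σ_{t∈Φ} ε(t))·τ(1)`.
[cite: TianYuanZhang2017, proof of Lemma 3.21 (p0020 L57–L62: "z^σ = z or z + τ(1) … Z(n)^α − Z(n) ∈ ℤτ(1)"); Thm. 3.6 (1) (p0012 L27–L29)] -/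
theorem galPt_sum_eq_add_sum_nsmul (hΓn : ∀ g γ, γ ∈ Γ → g * γ * g⁻¹ ∈ Γ) (hΓz : ∀ γ ∈ Γ, D.galPt γ z = z)
    {σ : D.H ≃ₐ[ℚ] D.H} (hσz : D.galPt σ z = z + tauOne) (Φ : Finset (D.H ≃ₐ[ℚ] D.H)) (g : D.H ≃ₐ[ℚ] D.H)
    (π : (D.H ≃ₐ[ℚ] D.H) → (D.H ≃ₐ[ℚ] D.H)) (ε : (D.H ≃ₐ[ℚ] D.H) → ℕ) (hπΦ : ∀ t ∈ Φ, π t ∈ Φ)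
    (hπinj : Set.InjOn π Φ) (hclass : ∀ t ∈ Φ, g * t * (π t * σ ^ ε t)⁻¹ ∈ Γ) :
    D.galPt g (∑ t ∈ Φ, D.galPt t z) = (∑ t ∈ Φ, D.galPt t z) + (∑ t ∈ Φ, ε t) • tauOne := by
  have hsurj : Set.SurjOn π Φ Φ := Finset.surjOn_of_injOn_of_card_le π (fun t ht => hπΦ t ht) hπinj le_rfl
  have hterm : ∀ t ∈ Φ, D.galPt (g * t) z = D.galPt (π t) z + ε t • tauOne := fun t ht => by
    have e : D.galPt (g * t) z = D.galPt (π t * σ ^ ε t) z :=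
      thetaPt_eq_of_mul_inv_mem D Γ z hΓn hΓz (hclass t ht)
    rw [e, galPt_mul, galPt_pow_of_eq_add_tauOne D hσz, map_add, galPt_nsmul_tauOne]
  rw [map_sum]
  calc ∑ t ∈ Φ, D.galPt g (D.galPt t z) = ∑ t ∈ Φ, (D.galPt (π t) z + ε t • tauOne) := by
          refine Finset.sum_congr rfl fun t ht => ?_
          rw [← galPt_mul, hterm t ht]
    _ = (∑ t ∈ Φ, D.galPt (π t) z) + ∑ t ∈ Φ, ε t • tauOne := Finset.sum_add_distrib
    _ = (∑ t ∈ Φ, D.galPt t z) + (∑ t ∈ Φ, ε t) • tauOne := by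
          have hre : ∑ t ∈ Φ, D.galPt (π t) z = ∑ t ∈ Φ, D.galPt t z :=
            Finset.sum_nbij π hπΦ hπinj hsurj (fun _ _ => rfl)
          rw [hre, Finset.sum_smul]

end Points

/-! ## §4 The permutation `π` and the exponents `ε` from «`Φ₀` represents `Gal(H′_d/L_d(i))/⟨σ⟩` exactly once» -/

section Representatives

variable {Ω : Type*} [Group Ω] (Q Γ : Subgroup Ω) (Φ : Finset Ω) (σ : Ω)

/-- **Choice of `π(t), ε(t)` for `g t`.**  If every element of `Q` is `≡ r` or `≡ rσ (mod Γ)` for some `r ∈ Φ` (`hrep`), then for `g ∈ Q`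
and `Φ ⊆ Q` there are `π : Ω → Ω`, `ε : Ω → ℕ` with `π(Φ) ⊆ Φ`, `ε ≤ 1`, and `g t ≡ π(t) σ^{ε(t)} (mod Γ)` on `Φ`.
[cite: TianYuanZhang2017, proof of Lemma 3.21 (p0020 L57–L60: "αΦ₀ = {σ_i t_i} where σ_i = σ or 1")] -/
theorem exists_perm_data (hΦ : ∀ t ∈ Φ, t ∈ Q) {g : Ω} (hg : g ∈ Q)
    (hrep : ∀ x ∈ Q, ∃ r ∈ Φ, x * r⁻¹ ∈ Γ ∨ x * (r * σ)⁻¹ ∈ Γ) :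
    ∃ (π : Ω → Ω) (ε : Ω → ℕ), (∀ t ∈ Φ, π t ∈ Φ) ∧ (∀ t ∈ Φ, ε t ≤ 1) ∧
      ∀ t ∈ Φ, g * t * (π t * σ ^ ε t)⁻¹ ∈ Γ := by
  have hch : ∀ t : Ω, t ∈ Φ → ∃ r ∈ Φ, ∃ e : ℕ, e ≤ 1 ∧ g * t * (r * σ ^ e)⁻¹ ∈ Γ := fun t ht => by
    obtain ⟨r, hr, h⟩ := hrep (g * t) (Q.mul_mem hg (hΦ t ht))
    rcases h with h | h
    · exact ⟨r, hr, 0, zero_le_one, by rwa [pow_zero, mul_one]⟩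
    · exact ⟨r, hr, 1, le_rfl, by rwa [pow_one]⟩
  choose! π hπΦ ε hε hcl using hch
  exact ⟨π, ε, hπΦ, hε, hcl⟩

/-- **`π` is injective on `Φ`.**  If `g t₁ ≡ r σ^{e₁}` and `g t₂ ≡ r σ^{e₂} (mod Γ)` with `Γ` normalised by `Q`, `Q/Γ` abelian and `σ² ∈ Γ`,
then `t₁ ≡ t₂` or `t₁ ≡ t₂ σ (mod Γ)`, so `t₁ = t₂` by the uniqueness half of «`Φ₀` is a set of representatives» (`huniq`).
[cite: TianYuanZhang2017, proof of Lemma 3.21 (p0020 L55–L62: "Φ₀ is a set of representatives of 2Cl_n = (2Cl′_n)/⟨σ⟩ in 2Cl′_n")] -/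
theorem injOn_of_perm_data (hΓQ : Γ ≤ Q) (hΓn : ∀ g ∈ Q, ∀ γ ∈ Γ, g * γ * g⁻¹ ∈ Γ)
    (hΦ : ∀ t ∈ Φ, t ∈ Q) (hσ : σ ∈ Q) (hσσ : σ * σ ∈ Γ) {g : Ω} (hg : g ∈ Q)
    (huniq : ∀ t₁ ∈ Φ, ∀ t₂ ∈ Φ, (t₁ * t₂⁻¹ ∈ Γ ∨ t₁ * (t₂ * σ)⁻¹ ∈ Γ) → t₁ = t₂)
    (π : Ω → Ω) (ε : Ω → ℕ) (hε : ∀ t ∈ Φ, ε t ≤ 1) (hclass : ∀ t ∈ Φ, g * t * (π t * σ ^ ε t)⁻¹ ∈ Γ) :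
    Set.InjOn π Φ := by
  intro t₁ ht₁ t₂ ht₂ hπ
  simp only [Finset.mem_coe] at ht₁ ht₂
  have h1 := hclass t₁ ht₁
  have h2 := hclass t₂ ht₂
  rw [← hπ] at h2
  -- membership bookkeeping: `π t₁ ∈ Q`
  have hrσ : π t₁ * σ ^ ε t₁ ∈ Q := by
    have e : π t₁ * σ ^ ε t₁ = (g * t₁ * (π t₁ * σ ^ ε t₁)⁻¹)⁻¹ * (g * t₁) := by group
    rw [e]; exact Q.mul_mem (Q.inv_mem (hΓQ h1)) (Q.mul_mem hg (hΦ t₁ ht₁))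
  have hr : π t₁ ∈ Q := by
    have e : π t₁ = π t₁ * σ ^ ε t₁ * (σ ^ ε t₁)⁻¹ := by group
    rw [e]; exact Q.mul_mem hrσ (Q.inv_mem (Q.pow_mem hσ _))
  have hm₂ : π t₁ * σ ^ ε t₂ ∈ Q := Q.mul_mem hr (Q.pow_mem hσ _)
  -- `h1⁻¹ h2 = (π t₁ σ^{ε₁}) (t₁⁻¹ t₂) (π t₁ σ^{ε₂})⁻¹ ∈ Γ`
  have hx : (π t₁ * σ ^ ε t₁) * (t₁⁻¹ * t₂) * (π t₁ * σ ^ ε t₂)⁻¹ ∈ Γ := by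
    have := Γ.mul_mem (Γ.inv_mem h1) h2
    rwa [show (g * t₁ * (π t₁ * σ ^ ε t₁)⁻¹)⁻¹ * (g * t₂ * (π t₁ * σ ^ ε t₂)⁻¹) =
      (π t₁ * σ ^ ε t₁) * (t₁⁻¹ * t₂) * (π t₁ * σ ^ ε t₂)⁻¹ by group] at this
  -- conjugate by `(π t₁ σ^{ε₂})⁻¹`: `σ^{-ε₂} σ^{ε₁} (t₁⁻¹ t₂) ∈ Γ`
  have hy : (σ ^ ε t₂)⁻¹ * σ ^ ε t₁ * (t₁⁻¹ * t₂) ∈ Γ := by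
    have := hΓn _ (Q.inv_mem hm₂) _ hx
    rwa [show (π t₁ * σ ^ ε t₂)⁻¹ * ((π t₁ * σ ^ ε t₁) * (t₁⁻¹ * t₂) * (π t₁ * σ ^ ε t₂)⁻¹) * (π t₁ * σ ^ ε t₂)⁻¹⁻¹ =
      (σ ^ ε t₂)⁻¹ * σ ^ ε t₁ * (t₁⁻¹ * t₂) by group] at this
  -- the two shapes of the conclusion
  have hL : t₁⁻¹ * t₂ ∈ Γ → t₂ * t₁⁻¹ ∈ Γ := fun h => by
    have := hΓn _ (hΦ t₁ ht₁) _ h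
    rwa [show t₁ * (t₁⁻¹ * t₂) * t₁⁻¹ = t₂ * t₁⁻¹ by group] at this
  have hR : σ⁻¹ * (t₁⁻¹ * t₂) ∈ Γ → t₂ * (t₁ * σ)⁻¹ ∈ Γ := fun h => by
    have hc := hΓn _ (Q.mul_mem (hΦ t₁ ht₁) hσ) _ h
    rwa [show t₁ * σ * (σ⁻¹ * (t₁⁻¹ * t₂)) * (t₁ * σ)⁻¹ = t₂ * (t₁ * σ)⁻¹ by group] at hc
  -- case analysis on `ε t₁, ε t₂ ∈ {0, 1}`
  have key : t₂ * t₁⁻¹ ∈ Γ ∨ t₂ * (t₁ * σ)⁻¹ ∈ Γ := by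
    rcases Nat.le_one_iff_eq_zero_or_eq_one.mp (hε t₁ ht₁) with h₁ | h₁ <;>
      rcases Nat.le_one_iff_eq_zero_or_eq_one.mp (hε t₂ ht₂) with h₂ | h₂ <;>
      rw [h₁, h₂] at hy
    · -- (0,0): `t₁⁻¹ t₂ ∈ Γ`
      left; apply hL; simpa using hy
    · -- (0,1): `σ⁻¹ (t₁⁻¹ t₂) ∈ Γ`
      right; apply hR; simpa using hy
    · -- (1,0): `σ (t₁⁻¹ t₂) ∈ Γ`, and `σ² ∈ Γ`
      right; apply hR
      have hy' : σ * (t₁⁻¹ * t₂) ∈ Γ := by simpa using hy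
      have := Γ.mul_mem (Γ.inv_mem (hΓn _ (Q.inv_mem hσ) _ hσσ)) hy'
      rwa [show (σ⁻¹ * (σ * σ) * σ⁻¹⁻¹)⁻¹ * (σ * (t₁⁻¹ * t₂)) = σ⁻¹ * (t₁⁻¹ * t₂) by group] at this
    · -- (1,1): `σ⁻¹ σ (t₁⁻¹ t₂) = t₁⁻¹ t₂ ∈ Γ`
      left; apply hL; simpa using hy
  exact (huniq t₂ ht₂ t₁ ht₁ key).symm

end Representatives

end Summit.BirchSwinnertonDyer.Rank1Residual.P2.GenusPeriodTransferLayer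

end
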